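import Literature.Computability.AlgebraicComplexity.MS21DiagonalTensorHasseSeparation
import HarnessLib

/-!
# Second Hasse derivatives of MULTILINEAR polynomials (toolkit for the characteristic-free repair of
# Medini–Shpilka 2021, Lemma 5.13 — registry item B36 of the cell `val-lit`)

Theorem-only toolkit file (seat t18 g5), on `MS21DiagonalTensorHasseSeparation.lean` (`taylorAlong`,
`hasseD`). Blueprint: `HOME/np/t18g5-MS21-thm35-B36-hasse-blueprint.md` (stage S1 of five).

[MediniShpilka2021, Lemma 5.13 (arXiv:2102.05632 p0029:L3-L26)] separates `f = ANF_Δ(A₁x)` from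
`g = ANF_Δ(A₂x)` by a second-order dual derivative; its bullet "`x^e` not multilinear, `x_i² ∣ x^e`,
`v = u = v_i` … clearly `∂²g/∂v∂u ≠ 0`" divides by `e_i(e_i - 1)` and fails in characteristic
`p ∣ e_i(e_i-1)`. As for Thm 45 (B35, closed in the tree), the repair replaces `∂²/∂v_i²` by the second
HASSE derivative `Δ²_{v_i}`. This file supplies the two facts about MULTILINEAR polynomials (such as
`ANF_Δ`, Obs 5.2) that the repair uses on the `f`-side and on the `g`-side:

* `MS2021.hasseD_single_monomial` — `Δ^k_{c·e_i} (a·x^m) = C(m_i,k) c^k a · x^{m - k e_i}` (so the pure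
  Hasse test sees a square with coefficient `C(2,2) = 1` in every characteristic), whence
  `MS2021.hasseD_single_eq_zero_of_degreeOf_lt`: `Δ^k_{c e_i} Q = 0` if `deg_{x_i} Q < k` — in
  particular `Δ²_{c e_i}` KILLS every multilinear polynomial ("as ANF is multilinear", the `f`-side);
* `MS2021.exists_hasseD_two_eq_sum_pderiv_pderiv` — for a multilinear `Q` and any direction `v`,
  `Δ²_v Q = Σ_a Σ_b α_{ab} ∂_a ∂_b Q` for some coefficients `α` (polarisation; the `g`-side: a second
  Hasse derivative of an `ANF`-orbit element is again "a linear combination of second derivatives of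
  `ANF`", the hypothesis shape of Lemmas 5.14/5.15).

No definitions, no facts (D-0026). HONEST FRAMING: toolkit lemmas towards a characteristic-free proof of
a 2021 published lemma; `VP ≠ VNP` is NOT proved and nothing here bears on it.

## References
* [MediniShpilka2021] D. Medini, A. Shpilka, CCC 2021 (LIPIcs 200:19) = arXiv:2102.05632: Lemma 5.13
  p0029:L3-L26 (the bullet p0029:L12-L14), Obs 5.2 (ANF multilinear) p0025, Def 3.6 p0017:L44-L49,
  Lemmas 5.14/5.15 p0029:L27–p0030:L26.
-/

noncomputable section

open MvPolynomial

namespace Literature.Computability.AlgebraicComplexity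

namespace MS2021

section Monomial

variable {K : Type*} [CommRing K] {σ : Type*} [DecidableEq σ]

/-- `z^k`-coefficient of `(p + q z)^n` (binomial theorem): `C(n,k) p^{n-k} q^k`. [folklore] -/
private theorem coeff_C_add_C_mul_X_pow {R : Type*} [CommRing R] (p q : R) (n k : ℕ) :
    ((Polynomial.C p + Polynomial.C q * Polynomial.X) ^ n).coeff k =
      (n.choose k : R) * p ^ (n - k) * q ^ k := by
  have hterm : ∀ m : ℕ, (Polynomial.C q * Polynomial.X) ^ m * Polynomial.C p ^ (n - m) *
      (n.choose m : Polynomial R) =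
      Polynomial.C ((n.choose m : R) * p ^ (n - m) * q ^ m) * Polynomial.X ^ m := by
    intro m
    rw [← map_natCast Polynomial.C (n.choose m)]
    simp only [Polynomial.C_mul, Polynomial.C_pow]
    ring
  rw [add_comm, add_pow, Polynomial.finsetSum_coeff]
  simp_rw [hterm, Polynomial.coeff_C_mul_X_pow]
  rw [Finset.sum_ite_eq (Finset.range (n + 1)) k]
  by_cases hk : k ∈ Finset.range (n + 1)
  · rw [if_pos hk]
  · rw [if_neg hk, Nat.choose_eq_zero_of_lt (by simpa using hk), Nat.cast_zero, zero_mul, zero_mul]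

omit [DecidableEq σ] in
/-- The Taylor shift is the constant embedding on polynomials whose variables the direction misses.
[cite: MediniShpilka2021, Def 3.6 (arXiv p0017:L44-L49)] -/
theorem taylorAlong_monomial_of_forall_eq_zero (u : σ → K) (s : σ →₀ ℕ) (a : K)
    (hu : ∀ j ∈ s.support, u j = 0) :
    taylorAlong u (monomial s a) = Polynomial.C (monomial s a) := by
  rw [taylorAlong, aeval_monomial, Polynomial.algebraMap_apply, algebraMap_eq, monomial_eq,
    Polynomial.C_mul]
  congr 1
  rw [Finsupp.prod, Finsupp.prod, map_prod]
  refine Finset.prod_congr rfl fun j hj => ?_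
  rw [hu j hj, C_0, Polynomial.C_0, zero_mul, add_zero, Polynomial.C_pow]

/-- **Hasse derivatives of a monomial along a coordinate direction**:
`Δ^k_{c e_i} (a x^m) = a x^{m - m_i e_i} · (C(m_i, k) x_i^{m_i - k} c^k)`; the binomial coefficient
`C(m_i, k)` (not the falling factorial `m_i (m_i - 1) ⋯`) is what makes the test characteristic-free
for `k = m_i`. [cite: MediniShpilka2021, Lemma 5.13 (arXiv p0029:L12-L14) and Def 3.6 (p0017:L44-L49)] -/
theorem hasseD_single_monomial (k : ℕ) (i : σ) (c : K) (m : σ →₀ ℕ) (a : K) :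
    hasseD k (Pi.single i c) (monomial m a) =
      monomial (m.erase i) a * (((m i).choose k : MvPolynomial σ K) * X i ^ (m i - k) * C c ^ k) := by
  have hm : monomial m a = monomial (m.erase i) a * X i ^ (m i) := by
    conv_lhs => rw [← Finsupp.erase_add_single i m]
    rw [monomial_add_single]
  rw [hasseD, hm, map_mul, map_pow, taylorAlong_X, Pi.single_eq_same,
    taylorAlong_monomial_of_forall_eq_zero _ _ _ (fun j hj => by
      rw [Finsupp.support_erase, Finset.mem_erase] at hj
      exact Pi.single_eq_of_ne hj.1 _),
    Polynomial.coeff_C_mul, coeff_C_add_C_mul_X_pow]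

/-- **`Δ^k_{c e_i} Q = 0` when `deg_{x_i} Q < k`**; for `k = 2` and a multilinear `Q` this is the
Hasse form of "`∂²ANF/∂x_i² = 0` as ANF is multilinear" (the `f`-side of Lemma 5.13), valid in
every characteristic. [cite: MediniShpilka2021, Lemma 5.13 (arXiv p0029:L12-L14), Obs 5.2 (p0025)] -/
theorem hasseD_single_eq_zero_of_degreeOf_lt (k : ℕ) (i : σ) (c : K) (Q : MvPolynomial σ K)
    (hQ : Q.degreeOf i < k) : hasseD k (Pi.single i c) Q = 0 := by
  classical
  conv_lhs => rw [Q.as_sum]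
  rw [hasseD_sum]
  refine Finset.sum_eq_zero fun m hm => ?_
  rw [hasseD_single_monomial, Nat.choose_eq_zero_of_lt ((monomial_le_degreeOf i hm).trans_lt hQ),
    Nat.cast_zero, zero_mul, zero_mul, mul_zero]

end Monomial

section Multilinear

variable {K : Type*} [CommRing K] {σ : Type*} [Fintype σ] [DecidableEq σ]

/-- **Second Hasse derivatives of a multilinear polynomial are combinations of mixed second partial
derivatives**: for `Q` with all individual degrees `≤ 1` and any direction `v` there are coefficients
`α` with `Δ²_v Q = Σ_a Σ_b α_{ab} ∂_a ∂_b Q` (polarisation `Δ²_{u+w} = Δ²_u + Δ²_w + ∂_u ∂_w`, the pure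
terms vanishing). On an `ANF`-orbit element this says that a second Hasse derivative is again "some
non-zero linear combination of second derivatives of ANF" — the hypothesis of Lemma 5.14 — so the
printed Lemmas 5.14/5.15 apply unchanged to the Hasse repair of Lemma 5.13.
[cite: MediniShpilka2021, Lemmas 5.13/5.14 (arXiv p0029:L3-L34)] -/
theorem exists_hasseD_two_eq_sum_pderiv_pderiv (Q : MvPolynomial σ K) (hQ : ∀ i, Q.degreeOf i ≤ 1)
    (v : σ → K) :
    ∃ α : σ → σ → K, hasseD 2 v Q = ∑ a, ∑ b, C (α a b) * pderiv a (pderiv b Q) := by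
  classical
  have key : ∀ s : Finset σ, ∃ α : σ → σ → K,
      hasseD 2 (∑ i ∈ s, Pi.single i (v i)) Q = ∑ a, ∑ b, C (α a b) * pderiv a (pderiv b Q) := by
    intro s
    induction s using Finset.induction_on with
    | empty =>
      refine ⟨fun _ _ => 0, ?_⟩
      rw [Finset.sum_empty, hasseD_dir_zero 2 two_ne_zero]
      simp only [C_0, zero_mul, Finset.sum_const_zero]
    | insert i s hi ih =>
      obtain ⟨α, hα⟩ := ih
      refine ⟨fun a b => α a b +
        (Pi.single i (v i) : σ → K) a * (∑ i' ∈ s, Pi.single i' (v i') : σ → K) b, ?_⟩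
      rw [Finset.sum_insert hi, hasseD_two_add, hα,
        hasseD_single_eq_zero_of_degreeOf_lt 2 i (v i) Q (Nat.lt_succ_of_le (hQ i)), zero_add,
        ← Finset.sum_add_distrib]
      refine Finset.sum_congr rfl fun a _ => ?_
      rw [← Finset.sum_add_distrib]
      refine Finset.sum_congr rfl fun b _ => ?_
      rw [C_add, add_mul]
  obtain ⟨α, hα⟩ := key Finset.univ
  refine ⟨α, ?_⟩
  rwa [Finset.univ_sum_single] at hα

omit [Fintype σ] in
/-- Coordinate form: for a multilinear `Q`, `Δ²_{c e_i} Q = 0` for every slot `i` and scalar `c`.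
[cite: MediniShpilka2021, Lemma 5.13 (arXiv p0029:L12-L14), Obs 5.2 (p0025)] -/
theorem hasseD_two_single_eq_zero_of_multilinear (Q : MvPolynomial σ K) (hQ : ∀ i, Q.degreeOf i ≤ 1)
    (i : σ) (c : K) : hasseD 2 (Pi.single i c) Q = 0 :=
  hasseD_single_eq_zero_of_degreeOf_lt 2 i c Q (Nat.lt_succ_of_le (hQ i))

end Multilinear

end MS2021

end Literature.Computability.AlgebraicComplexity
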